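import Mathlib
import Summits.Ventures.PercRepro2.Defs
import Summits.Ventures.PercRepro2.Graph
import Summits.Ventures.PercRepro2.OneColourSwitch
import Summits.Ventures.PercRepro2.RegionHubSign
import Summits.Ventures.PercRepro2.SideSwitch
import Summits.Ventures.PercRepro2.SideSwitchFibre
import Summits.Ventures.PercRepro2.SideSwitchMono
import Summits.Ventures.PercRepro2.SideSwitchM9
import Summits.Ventures.PercRepro2.SideSwitchClosed
import Summits.Ventures.PercRepro2.SideSwitchComps
import Summits.Ventures.PercRepro2.SideSwitchCompsFibre

/-!
# Monotonicity on the hypercube of component assignments (blind cell PercRepro2, p3 g18,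
2026-08-27; `proofs/P3-CPNC.md` §15e, general form)

The three path-monotonicity lemmas and the complement identity of `SideSwitchMono`, for the
component assignments `assignC T ρ` of a representative `ρ` (`T ⊆ T' ⊆ comps ρ`): `p ~_Y q` is
increasing, `r ~_Y s` decreasing, `r ~_W s` increasing, and `p ~_W q` in the assignment `T` is
`p ~_Y q` in the assignment `comps ∖ T` of the outside-flipped representative.  The proofs are
those of `SideSwitchMono` with the closed switch lemma (`SideSwitchClosed`) in place of the
no-non-mark-edge hypothesis.  Own work; std axioms.
-/

namespace Summit.Ventures.PercRepro2

namespace SideSwitch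

open Finset Classical RegionHub OneColourSwitch

variable {V : Type*} {E : Type*}

section Count

variable [Fintype V] [DecidableEq V] [Fintype E] [DecidableEq E]

variable {ends : E → Sym2 V}

/-- A vertex of `⋃T' ∖ ⋃T` lies on the `Y`-side of the component assignment `T`. -/
lemma sideC_of_mem_sdiff {p q r s : V} {ρ : Config E} (hρ : ρ ∈ Rep ends p q r s)
    {T T' : Finset (Finset V)} (hTT : T ⊆ T') (hT' : T' ⊆ comps ends r s ρ) {x : V}
    (hx : x ∈ unionT T' \ unionT T) :
    x ∈ K2 ends r s (assignC ends T ρ) ∧ x ∉ M2 ends r s (assignC ends T ρ) := by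
  obtain ⟨h, hM⟩ := mem_Rep.1 hρ
  obtain ⟨h1, h2, h3, h4⟩ := switch_data_unionT (hTT.trans hT')
  obtain ⟨hxT', hxT⟩ := Finset.mem_sdiff.1 hx
  have hxA : x ∈ A0 ends r s ρ := unionT_subset_A0 hT' hxT'
  have hxK : x ∈ K2 ends r s ρ := A0_subset_K2_of_mem_Rep hρ hxA
  obtain ⟨_, hxr, hxs⟩ := mem_A0.1 hxA
  simp only [assignC, assign]
  rw [K2_flipTouch_of_closed h h1 h2 h3 h4, M2_flipTouch_of_closed h h1 h2 h3 h4]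
  refine ⟨Or.inl ⟨hxK, fun h' => hxT (Finset.mem_coe.1 h')⟩, ?_⟩
  rintro (⟨hxM, _⟩ | ⟨hxT'', _⟩)
  · rcases hM x hxM with h' | h'
    · exact hxr h'
    · exact hxs h'
  · exact hxT (Finset.mem_coe.1 hxT'')

/-- A vertex of `⋃T` lies on the `W`-side of the component assignment `T`. -/
lemma sideC_of_mem {p q r s : V} {ρ : Config E} (hρ : ρ ∈ Rep ends p q r s)
    {T : Finset (Finset V)} (hT : T ⊆ comps ends r s ρ) {x : V} (hx : x ∈ unionT T) :
    x ∉ K2 ends r s (assignC ends T ρ) ∧ x ∈ M2 ends r s (assignC ends T ρ) := by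
  obtain ⟨h, hM⟩ := mem_Rep.1 hρ
  obtain ⟨h1, h2, h3, h4⟩ := switch_data_unionT hT
  have hxA : x ∈ A0 ends r s ρ := unionT_subset_A0 hT hx
  have hxK : x ∈ K2 ends r s ρ := A0_subset_K2_of_mem_Rep hρ hxA
  obtain ⟨_, hxr, hxs⟩ := mem_A0.1 hxA
  simp only [assignC, assign]
  rw [K2_flipTouch_of_closed h h1 h2 h3 h4, M2_flipTouch_of_closed h h1 h2 h3 h4]
  refine ⟨?_, Or.inr ⟨Finset.mem_coe.2 hx, hxK⟩⟩
  rintro (⟨_, hxT⟩ | ⟨_, hxM⟩)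
  · exact hxT (Finset.mem_coe.2 hx)
  · rcases hM x hxM with h' | h'
    · exact hxr h'
    · exact hxs h'

/-- (M1) `p ~_Y q` is increasing in the component assignment. -/
lemma conn_pq_assignC_mono {p q r s : V} {ρ : Config E} (hρ : ρ ∈ Rep ends p q r s)
    {T T' : Finset (Finset V)} (hTT : T ⊆ T') (hT' : T' ⊆ comps ends r s ρ)
    (hc : Conn ends (assignC ends T ρ) p q) : Conn ends (assignC ends T' ρ) p q := by
  have hsep : sep2 ends p q r s (assignC ends T ρ) :=
    sep2_assignC (mem_Rep.1 hρ).1 (hTT.trans hT')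
  refine conn_of_eqOn_notTouches (H := ({r, s} : Set V)) (ω := assignC ends T ρ)
    (ω' := assignC ends T' ρ) (not_mem_K2_of_sep2 hsep).1 ?_ hc
  intro e he
  refine assign_eq_of_notMem_touches_sdiff (unionT_mono hTT) ?_
  rintro ⟨x, hx, y, hxy⟩
  exact he ⟨x, (sideC_of_mem_sdiff hρ hTT hT' (Finset.mem_coe.1 hx)).1, y, hxy⟩

/-- (M2) `r ~_Y s` is decreasing in the component assignment. -/
lemma conn_rs_assignC_anti {p q r s : V} {ρ : Config E} (hρ : ρ ∈ Rep ends p q r s)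
    {T T' : Finset (Finset V)} (hTT : T ⊆ T') (hT' : T' ⊆ comps ends r s ρ)
    (hc : Conn ends (assignC ends T' ρ) r s) : Conn ends (assignC ends T ρ) r s := by
  refine conn_of_eqOn_notTouches (H := (↑(unionT T' \ unionT T) : Set V))
    (ω := assignC ends T' ρ) (ω' := assignC ends T ρ) ?_ ?_ hc
  · rintro ⟨x, hx, hxr⟩
    have hxT' : x ∈ unionT T' := (Finset.mem_sdiff.1 (Finset.mem_coe.1 hx)).1
    exact (sideC_of_mem hρ hT' hxT').1 (mem_K2_iff.2 (Or.inl (conn_symm hxr)))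
  · intro e he
    refine (assign_eq_of_notMem_touches_sdiff (unionT_mono hTT) ?_).symm
    rintro ⟨x, hx, y, hxy⟩
    exact he ⟨x, ⟨x, hx, conn_refl _ _ _⟩, y, hxy⟩

/-- (M3) `r ~_W s` is increasing in the component assignment. -/
lemma conn_rs_compl_assignC_mono {p q r s : V} {ρ : Config E} (hρ : ρ ∈ Rep ends p q r s)
    {T T' : Finset (Finset V)} (hTT : T ⊆ T') (hT' : T' ⊆ comps ends r s ρ)
    (hc : Conn ends (OneColourSwitch.compl (assignC ends T ρ)) r s) :
    Conn ends (OneColourSwitch.compl (assignC ends T' ρ)) r s := by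
  refine conn_of_eqOn_notTouches (H := (↑(unionT T' \ unionT T) : Set V))
    (ω := OneColourSwitch.compl (assignC ends T ρ))
    (ω' := OneColourSwitch.compl (assignC ends T' ρ)) ?_ ?_ hc
  · rintro ⟨x, hx, hxr⟩
    exact (sideC_of_mem_sdiff hρ hTT hT' (Finset.mem_coe.1 hx)).2
      (mem_M2_iff.2 (Or.inl (conn_symm hxr)))
  · intro e he
    have hnt : e ∉ touches ends (↑(unionT T' \ unionT T) : Set V) := by
      rintro ⟨x, hx, y, hxy⟩
      exact he ⟨x, ⟨x, hx, conn_refl _ _ _⟩, y, hxy⟩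
    simp only [OneColourSwitch.compl, assignC]
    rw [assign_eq_of_notMem_touches_sdiff (unionT_mono hTT) hnt]

omit [Fintype E] [DecidableEq E] in
/-- No edge touches both a union of components and its complement in `A0`. -/
lemma not_touches_both_unionT {r s : V} {ρ : Config E}
    {T : Finset (Finset V)} (hT : T ⊆ comps ends r s ρ) {e : E}
    (h1 : e ∈ touches ends (↑(unionT T) : Set V))
    (h2 : e ∈ touches ends (↑(A0 ends r s ρ \ unionT T) : Set V)) : False := by
  obtain ⟨x, hx, y, hxy⟩ := h1
  obtain ⟨z, hz, w, hzw⟩ := h2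
  obtain ⟨hzA, hzT⟩ := Finset.mem_sdiff.1 (Finset.mem_coe.1 hz)
  have hcl := closedIn_unionT hT
  rw [hxy, Sym2.eq_iff] at hzw
  rcases hzw with ⟨h1', _⟩ | ⟨_, h2'⟩
  · exact hzT (h1' ▸ Finset.mem_coe.1 hx)
  · have hzS : z ∈ sided ends r s ρ := by rw [sided_eq_coe_A0]; exact Finset.mem_coe.2 hzA
    rw [← h2'] at hzS hzT
    exact hzT (Finset.mem_coe.1 (hcl e x y hxy hx hzS))

/-- **The complement identity, pointwise, for a union of components**: off the `r`–`s` edges,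
the complement of the assignment `T` is the assignment `A0 ∖ ⋃T` of the outside-flipped
representative. -/
lemma compl_assignC_eq_off_rs {p q r s : V} {ρ : Config E} (hρ : ρ ∈ Rep ends p q r s)
    {T : Finset (Finset V)} (hT : T ⊆ comps ends r s ρ) {e : E}
    (he : e ∉ within ends ({r, s} : Set V)) :
    OneColourSwitch.compl (assignC ends T ρ) e =
      assign ends (A0 ends r s ρ \ unionT T) (flipIn ends (Oset ends r s ρ) ρ) e := by
  obtain ⟨h, _⟩ := mem_Rep.1 hρ
  set T₀ := unionT T with hT₀
  have hT₀A : T₀ ⊆ A0 ends r s ρ := unionT_subset_A0 hT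
  have hTc : A0 ends r s ρ \ T₀ ⊆ A0 ends r s ρ := Finset.sdiff_subset
  obtain ⟨x, y, hxy⟩ : ∃ x y, ends e = s(x, y) := Sym2.ind (fun x y => ⟨x, y, rfl⟩) (ends e)
  simp only [OneColourSwitch.compl, assignC, assign, flipTouch, flipIn]
  by_cases h1 : e ∈ touches ends (↑T₀ : Set V)
  · have h2 : e ∉ touches ends (↑(A0 ends r s ρ \ T₀) : Set V) := fun h2 =>
      not_touches_both_unionT hT h1 h2
    have h3 : e ∉ within ends (Oset ends r s ρ) := not_within_Oset_of_touches_A0 hT₀A h1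
    rw [if_pos h1, if_neg h2, if_neg h3, Bool.not_not]
  by_cases h2 : e ∈ touches ends (↑(A0 ends r s ρ \ T₀) : Set V)
  · have h3 : e ∉ within ends (Oset ends r s ρ) := not_within_Oset_of_touches_A0 hTc h2
    rw [if_neg h1, if_pos h2, if_neg h3]
  have hxA : x ∉ A0 ends r s ρ := by
    intro hx
    by_cases hxT : x ∈ T₀
    · exact h1 ⟨x, Finset.mem_coe.2 hxT, y, hxy⟩
    · exact h2 ⟨x, Finset.mem_coe.2 (Finset.mem_sdiff.2 ⟨hx, hxT⟩), y, hxy⟩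
  have hyx : ends e = s(y, x) := by rw [hxy, Sym2.eq_swap]
  have hyA : y ∉ A0 ends r s ρ := by
    intro hy
    by_cases hyT : y ∈ T₀
    · exact h1 ⟨y, Finset.mem_coe.2 hyT, x, hyx⟩
    · exact h2 ⟨y, Finset.mem_coe.2 (Finset.mem_sdiff.2 ⟨hy, hyT⟩), x, hyx⟩
  have hcases : ∀ z, z ∉ A0 ends r s ρ → z = r ∨ z = s ∨ z ∈ Oset ends r s ρ := by
    intro z hz
    rcases vertex_cases (ends := ends) (r := r) (s := s) ρ z with h' | h' | h' | h'
    · exact Or.inl h'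
    · exact Or.inr (Or.inl h')
    · exact (hz h').elim
    · exact Or.inr (Or.inr h')
  have hO : ∀ z, z ∈ Oset ends r s ρ → z ∉ K2 ends r s ρ ∧ z ∉ M2 ends r s ρ := by
    intro z hz
    have hz' : z ∉ K2 ends r s ρ ∪ M2 ends r s ρ := hz
    exact ⟨fun h' => hz' (Or.inl h'), fun h' => hz' (Or.inr h')⟩
  have hmark : ∀ z, z = r ∨ z = s → z ∈ ({r, s} : Set V) := by
    rintro z (h' | h')
    · exact Set.mem_insert_iff.2 (Or.inl h')
    · exact Set.mem_insert_iff.2 (Or.inr (Set.mem_singleton_iff.2 h'))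
  have hnot : ¬ ((x = r ∨ x = s) ∧ (y = r ∨ y = s)) := by
    rintro ⟨hx', hy'⟩
    exact he ⟨x, hmark x hx', y, hmark y hy', hxy⟩
  have houtr : ∀ z w, ends e = s(z, w) → z = r ∨ z = s → w ∈ Oset ends r s ρ → False := by
    intro z w hzw hz hw
    rcases hz with rfl | rfl
    · exact not_edge_r_outside h (hO w hw).1 (hO w hw).2 hzw
    · exact not_edge_s_outside h (hO w hw).1 (hO w hw).2 hzw
  rcases hcases x hxA with hx' | hx' | hxO
  · rcases hcases y hyA with hy' | hy' | hyO
    · exact (hnot ⟨Or.inl hx', Or.inl hy'⟩).elim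
    · exact (hnot ⟨Or.inl hx', Or.inr hy'⟩).elim
    · exact (houtr x y hxy (Or.inl hx') hyO).elim
  · rcases hcases y hyA with hy' | hy' | hyO
    · exact (hnot ⟨Or.inr hx', Or.inl hy'⟩).elim
    · exact (hnot ⟨Or.inr hx', Or.inr hy'⟩).elim
    · exact (houtr x y hxy (Or.inr hx') hyO).elim
  · rcases hcases y hyA with hy' | hy' | hyO
    · exact (houtr y x hyx (Or.inl hy') hxO).elim
    · exact (houtr y x hyx (Or.inr hy') hxO).elim
    · have h3 : e ∈ within ends (Oset ends r s ρ) := ⟨x, hxO, y, hyO, hxy⟩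
      rw [if_neg h1, if_neg h2, if_pos h3]

/-- (M4) **The complement identity for component assignments**: `p ~_W q` in the assignment
`T` is `p ~_Y q` in the assignment `comps ∖ T` of the outside-flipped representative. -/
lemma conn_pq_compl_assignC {p q r s : V} {ρ : Config E} (hρ : ρ ∈ Rep ends p q r s)
    {T : Finset (Finset V)} (hT : T ⊆ comps ends r s ρ) :
    Conn ends (OneColourSwitch.compl (assignC ends T ρ)) p q ↔
      Conn ends (assignC ends (comps ends r s ρ \ T) (flipO ends r s ρ)) p q := by
  have hρO : flipO ends r s ρ ∈ Rep ends p q r s := flipO_mem_Rep hρ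
  have hcompsO : comps ends r s (flipO ends r s ρ) = comps ends r s ρ := by
    simp only [comps, A0_flipO]
  have hTc : comps ends r s ρ \ T ⊆ comps ends r s (flipO ends r s ρ) := by
    rw [hcompsO]; exact Finset.sdiff_subset
  have hsepT : sep2 ends p q r s (assignC ends T ρ) := sep2_assignC (mem_Rep.1 hρ).1 hT
  have hsepTc : sep2 ends p q r s (assignC ends (comps ends r s ρ \ T) (flipO ends r s ρ)) :=
    sep2_assignC (mem_Rep.1 hρO).1 hTc
  have hrs_touch : ∀ {ω : Config E} {e : E}, e ∈ within ends ({r, s} : Set V) →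
      e ∈ touches ends (K2 ends r s ω) := by
    intro ω e hrs
    obtain ⟨z, hz, w, _, hzw⟩ := hrs
    refine ⟨z, ?_, w, hzw⟩
    rcases Set.mem_insert_iff.1 hz with rfl | hz'
    · exact r_mem_K2 _ _ _
    · rw [Set.mem_singleton_iff.1 hz']; exact s_mem_K2 _ _ _
  have hunion : unionT (comps ends r s ρ \ T) = A0 ends r s ρ \ unionT T := unionT_sdiff_comps hT
  have hpt : ∀ {e : E}, e ∉ within ends ({r, s} : Set V) →
      OneColourSwitch.compl (assignC ends T ρ) e =
        assignC ends (comps ends r s ρ \ T) (flipO ends r s ρ) e := by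
    intro e he
    have := compl_assignC_eq_off_rs hρ hT he
    simp only [assignC, flipO] at this ⊢
    rw [hunion]
    exact this
  constructor
  · intro hc
    refine conn_of_eqOn_notTouches (H := ({r, s} : Set V))
      (ω := OneColourSwitch.compl (assignC ends T ρ)) (not_mem_M2_of_sep2 hsepT).1 ?_ hc
    intro e he
    exact (hpt (fun hrs => he (hrs_touch hrs))).symm
  · intro hc
    refine conn_of_eqOn_notTouches (H := ({r, s} : Set V))
      (ω := assignC ends (comps ends r s ρ \ T) (flipO ends r s ρ))
      (not_mem_K2_of_sep2 hsepTc).1 ?_ hc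
    intro e he
    exact hpt (fun hrs => he (hrs_touch hrs))

end Count

end SideSwitch

end Summit.Ventures.PercRepro2
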